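import Literature.NumberTheory.LFunctions.WeilSemilocalCompactnessProofs
import HarnessLib

/-!
# Coercivity of the Weil form modulo finitely many linear conditions, on every window
# (Yoshida 1992, Lemma 3 — fine-grid variant)

Literature/NumberTheory/LFunctions. H. Yoshida, *On Hermitian forms attached to zeta functions*,
Adv. Stud. Pure Math. **21** (1992), 281–325 (bib `Yoshida1992HermitianForms`; held copy
`paper:url-4f57c7fe9c4c`), §3 "Positive definiteness for highly oscillating functions", p. 290,
**Lemma 3**, verbatim:

> Suppose that `a₀ > 0` and `μ > 0` are given. Then there exists a non-negative integer `N` such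
> that `(φ, φ) ≥ μ ‖φ‖²` for every `φ ∈ K_N(a)`, `0 < a ≤ a₀`.

where (p. 290) `K_N(a) = {φ ∈ K(a) : ∫_{-a}^{a} φ(x) exp(-πinx/a) dx = 0 for all n ∈ ℤ, |n| ≤ N}`,
`‖φ‖` is the `L²` norm and `(φ, φ)` is Weil's hermitian form (for `k = ℚ`: `Re Q(φ)`,
`Q = weilQuadratic`, by the explicit formula). In the normalisation of this directory
(`ĝ(1/2 + it) = ∫ g(x) e^{itx} dx`, `weilMellin_half_line_eq`) Yoshida's `2N + 1` conditions read
`ĝ(1/2 + iπn/a) = 0` (`|n| ≤ N`): the transform vanishes on the grid `(π/a)ℤ ∩ [-πN/a, πN/a]` of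
FIXED mesh `π/a`, and his proof (pp. 290–291) expands `φ` in the Fourier basis `χ_n` of
`L²([-a, a])` and bounds `|φ̂(t)| ≤ C (1 + a|t|) (Σ_{|n|>N} |c_n|/(π|n|))` by termwise partial
integration.

## What is proved here (`k = ℚ`), and the deviation from the printed lemma

* `weilQuadratic_re_ge_of_grid_zero` — for every window `a > 0` and every level `μ : ℝ` there are
  `T > 0` and `N ≥ 1` such that every test function `g` with `tsupport g ⊆ [-a, a]` whose transform
  vanishes at the `N + 1` grid points `tⱼ = -T + j · (2T/N)` (`j = 0, …, N`) of `[-T, T]` satisfies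
  `μ ∫ |g|² ≤ Re Q(g)`. So on EVERY window the Weil form is bounded below by any prescribed `μ`
  on a subspace of FINITE codimension cut out by explicit vanishing conditions of the transform on
  the critical line; the number of conditions depends on `(a, μ)` only.
* `weilQuadratic_re_ge_of_grid_zero_uniform` — the same with Yoshida's uniformity clause
  `0 < a ≤ a₀` (trivial here, because our conditions depend on `a₀` only and a test function on
  `[-a, a]` is one on `[-a₀, a₀]`).
* `weilQuadratic_re_nonneg_of_grid_zero` — the case `μ = 0`: positivity of the Weil form modulo
  finitely many linear conditions holds on every window, unconditionally.

DEVIATION (stated, not hidden): the conditions are NOT Yoshida's. We use a FINE grid (mesh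
`2T/N → 0`, `N ≍ a^{3/2} T^{3/2}`) instead of his Fourier grid (mesh `π/a`, `N ≍ aT`), which lets the
proof run on the elementary estimates already in the tree (proof of Connes–Consani–Moscovici 2025,
Thm. 3.6, `WeilSemilocalCompactnessProofs.lean`) instead of the Fourier expansion on `[-a, a]`:
(1) the polar and prime terms are bounded on the window, `weilArchIntegral_le_weilQuadratic_re`:
`(1/2π) ∫ |ĝ(1/2+it)|² Re ψ(1/4+it/2) dt ≤ Re Q(g) + K(a) ‖g‖₂²`; (2) the archimedean weight
`Re ψ(1/4+it/2) → +∞`, `exists_le_reDigammaQuarter_of_le_abs`, so beyond `|t| ≥ T` it exceeds any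
level `L`; (3) on `[-T, T]` the transform of a function on the window is `a‖g‖₁`-Lipschitz,
`norm_weilMellin_half_line_sub_le`, hence, vanishing on a grid of mesh `2T/N`, it is uniformly
`O(aT‖g‖₁/N)` there (`norm_sq_weilMellin_le_of_grid_zero`); (4) Plancherel,
`integral_norm_sq_weilMellin_half_line`. Choosing `L - ψ(1/4) ≥ 2(μ + K(a) - ψ(1/4))` and then
`N² ≥ 16 a³ T³/π` gives the claim. Consequently the count of conditions here is weaker (larger) than
Yoshida's `2N + 1`; the printed Lemma 3 with its Fourier conditions is NOT vendored as a named fact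
(nothing in the tree needs it), and neither is Prop. 2 (non-degeneracy, p. 291).

Why this file exists (cell pub-rhdoor, located-gap analysis of the Connes–Consani programme): a
theorem of the shape "the (semi)local Weil form is positive on the window after imposing finitely
many linear conditions" carries no arithmetic content by itself — it holds on every window for the
full Weil form of `ζ_ℚ`, by the soft argument formalised here; the content of such a theorem lies in
the COUNT of the conditions or in an operator lower bound (e.g. a trace term), not in finiteness.

## References
* H. Yoshida, Adv. Stud. Pure Math. 21 (1992), §3, Lemma 3 (p. 290, proof pp. 290–291), Prop. 2
  (p. 291). (key `Yoshida1992HermitianForms`)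
* A. Connes, C. Consani, H. Moscovici, *Zeta spectral triples*, arXiv:2511.22755 (2025), §3.2,
  proof of Thm. 3.6 (eqs. (3.24)–(3.26)) — the estimates reused. (key `ConnesConsaniMoscovici2025`)
* E. Bombieri, Rend. Lincei (9) 11 (2000), §4 Lemma 3 (bounded polar and prime terms).
-/

noncomputable section

open Complex Filter Set MeasureTheory
open scoped Real Topology ComplexConjugate ArithmeticFunction.vonMangoldt

namespace Literature.NumberTheory.LFunctions

open Literature.Analysis.SpecialFunctions

variable {g : ℝ → ℂ}

/-! ## The window estimate: vanishing on a fine grid makes `ĝ` small on `[-T, T]` -/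

/-- **Window estimate.** If `tsupport g ⊆ [-a, a]` and `ĝ(1/2 + itⱼ) = 0` at the grid points
`tⱼ = -T + j (2T/N)`, `j ≤ N`, then `|ĝ(1/2 + it)|² ≤ (8 a³ T² / N²) ‖g‖₂²` for `t ∈ [-T, T]`
(every `t` is within `2T/N` of a grid point, `exists_grid_point_near`; `ĝ` is `a‖g‖₁`-Lipschitz on
the line, `norm_weilMellin_half_line_sub_le`; `‖g‖₁² ≤ 2a‖g‖₂²`, `weilNorm1_sq_le`). [folklore] -/
theorem norm_sq_weilMellin_le_of_grid_zero (hg : IsWeilTest g) {a : ℝ} (ha : 0 < a)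
    (hsupp : tsupport g ⊆ Icc (-a) a) {T : ℝ} (hT : 0 < T) {N : ℕ} (hN : 1 ≤ N)
    (hzero : ∀ j : ℕ, j ≤ N →
      weilMellin g (1 / 2 + ((-T + j * (2 * T / N) : ℝ) : ℂ) * I) = 0)
    {t : ℝ} (ht : t ∈ Icc (-T) T) :
    ‖weilMellin g (1 / 2 + t * I)‖ ^ 2 ≤ 8 * a ^ 3 * T ^ 2 / (N : ℝ) ^ 2 * weilNorm2Sq g := by
  obtain ⟨j, hj⟩ := exists_grid_point_near hT hN ht
  have hjN : (j : ℕ) ≤ N := Nat.lt_succ_iff.mp j.isLt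
  have h0 := hzero j hjN
  set s : ℝ := -T + (j : ℕ) * (2 * T / N) with hs
  have hNpos : (0 : ℝ) < N := by exact_mod_cast hN
  have hmesh : 0 ≤ 2 * T / N := by positivity
  -- Lipschitz step
  have h1 : ‖weilMellin g (1 / 2 + t * I)‖ ≤ a * (2 * T / N) * weilNorm1 g := by
    have e : weilMellin g (1 / 2 + t * I) =
        weilMellin g (1 / 2 + t * I) - weilMellin g (1 / 2 + s * I) := by
      rw [h0, sub_zero]
    rw [e]
    refine (norm_weilMellin_half_line_sub_le hg hsupp t s).trans ?_
    have hw : 0 ≤ weilNorm1 g := weilNorm1_nonneg g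
    have hts : |t - s| ≤ 2 * T / N := hj
    have : a * |t - s| ≤ a * (2 * T / N) := mul_le_mul_of_nonneg_left hts ha.le
    exact mul_le_mul_of_nonneg_right this hw
  -- square and use `‖g‖₁² ≤ 2a ‖g‖₂²`
  have h2 : ‖weilMellin g (1 / 2 + t * I)‖ ^ 2 ≤ (a * (2 * T / N) * weilNorm1 g) ^ 2 :=
    pow_le_pow_left₀ (norm_nonneg _) h1 2
  have h3 : weilNorm1 g ^ 2 ≤ 2 * a * weilNorm2Sq g := weilNorm1_sq_le hg ha hsupp
  have h4 : (a * (2 * T / N) * weilNorm1 g) ^ 2 = a ^ 2 * (2 * T / N) ^ 2 * weilNorm1 g ^ 2 := by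
    ring
  have h5 : a ^ 2 * (2 * T / N) ^ 2 * weilNorm1 g ^ 2 ≤
      a ^ 2 * (2 * T / N) ^ 2 * (2 * a * weilNorm2Sq g) :=
    mul_le_mul_of_nonneg_left h3 (by positivity)
  have h6 : a ^ 2 * (2 * T / N) ^ 2 * (2 * a * weilNorm2Sq g) =
      8 * a ^ 3 * T ^ 2 / (N : ℝ) ^ 2 * weilNorm2Sq g := by
    field_simp
    ring
  calc ‖weilMellin g (1 / 2 + t * I)‖ ^ 2 ≤ (a * (2 * T / N) * weilNorm1 g) ^ 2 := h2
    _ = a ^ 2 * (2 * T / N) ^ 2 * weilNorm1 g ^ 2 := h4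
    _ ≤ a ^ 2 * (2 * T / N) ^ 2 * (2 * a * weilNorm2Sq g) := h5
    _ = 8 * a ^ 3 * T ^ 2 / (N : ℝ) ^ 2 * weilNorm2Sq g := h6

/-! ## Lemma 3 (fine-grid variant) -/

/-- **Coercivity of the Weil form modulo finitely many vanishing conditions, on every window**
(Yoshida 1992, Lemma 3, p. 290 — fine-grid variant, see the module docstring for the deviation):
for every `a > 0` and every `μ : ℝ` there are `T > 0` and `N ≥ 1` such that every test function `g`
with `tsupport g ⊆ [-a, a]` and `ĝ(1/2 + itⱼ) = 0` at the `N + 1` points `tⱼ = -T + j(2T/N)`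
(`j = 0, …, N`) satisfies `μ ∫ |g|² ≤ Re Q(g)`. Proof: bounded polar/prime terms
(`weilArchIntegral_le_weilQuadratic_re`), weight `Re ψ(1/4+it/2) ≥ L` off `[-T, T]`
(`exists_le_reDigammaQuarter_of_le_abs`), the window estimate
`norm_sq_weilMellin_le_of_grid_zero`, and Plancherel. [cite: Yoshida1992HermitianForms, §3 Lemma 3 (p. 290)] -/
theorem weilQuadratic_re_ge_of_grid_zero {a : ℝ} (ha : 0 < a) (μ : ℝ) :
    ∃ T : ℝ, 0 < T ∧ ∃ N : ℕ, 1 ≤ N ∧ ∀ g : ℝ → ℂ, IsWeilTest g → tsupport g ⊆ Icc (-a) a →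
      (∀ j : ℕ, j ≤ N → weilMellin g (1 / 2 + ((-T + j * (2 * T / N) : ℝ) : ℂ) * I) = 0) →
      μ * ∫ t : ℝ, ‖g t‖ ^ 2 ≤ (weilQuadratic g).re := by
  -- constants of the window
  set ρ₀ : ℝ := reDigammaQuarter 0 with hρ₀
  set K : ℝ := 2 * (Real.sinh a - a)
    + 2 * (∑ n ∈ Finset.range (⌊Real.exp (2 * a)⌋₊ + 1), (Λ n : ℝ) / Real.sqrt n)
    + Real.log π with hK
  -- the level beyond which the weight must lie
  set L : ℝ := ρ₀ + 2 * |μ + K - ρ₀| + 2 with hL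
  set ℓ : ℝ := L - ρ₀ with hℓ
  have hℓpos : 0 < ℓ := by
    have : 0 ≤ |μ + K - ρ₀| := abs_nonneg _
    rw [hℓ, hL]; linarith
  have hℓge : 2 * μ + 2 * K - 2 * ρ₀ ≤ ℓ := by
    have : μ + K - ρ₀ ≤ |μ + K - ρ₀| := le_abs_self _
    rw [hℓ, hL]; linarith
  obtain ⟨T, hT, hLT⟩ := exists_le_reDigammaQuarter_of_le_abs L
  -- the number of grid points
  set N : ℕ := ⌈16 * a ^ 3 * T ^ 3 / π⌉₊ + 1 with hN
  have hN1 : 1 ≤ N := Nat.le_add_left 1 _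
  have hNreal : 16 * a ^ 3 * T ^ 3 / π ≤ (N : ℝ) := by
    have h1 : 16 * a ^ 3 * T ^ 3 / π ≤ (⌈16 * a ^ 3 * T ^ 3 / π⌉₊ : ℝ) := Nat.le_ceil _
    have h2 : ((⌈16 * a ^ 3 * T ^ 3 / π⌉₊ : ℕ) : ℝ) ≤ (N : ℝ) := by
      rw [hN]; push_cast; linarith
    exact h1.trans h2
  have hN1r : (1 : ℝ) ≤ N := by exact_mod_cast hN1
  have hNsq : 16 * a ^ 3 * T ^ 3 / π ≤ (N : ℝ) ^ 2 := by
    have : (N : ℝ) ≤ (N : ℝ) ^ 2 := by nlinarith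
    exact hNreal.trans this
  have hNpos : (0 : ℝ) < N := by linarith
  refine ⟨T, hT, N, hN1, fun g hg hsupp hzero ↦ ?_⟩
  -- abbreviations
  set n2 : ℝ := ∫ t : ℝ, ‖g t‖ ^ 2 with hn2
  have hn2' : weilNorm2Sq g = n2 := rfl
  have hn2nn : 0 ≤ n2 := integral_nonneg fun _ ↦ by positivity
  set H : ℝ → ℂ := fun t ↦ weilMellin g (1 / 2 + t * I) with hH
  set A : ℝ := ∫ t : ℝ, ‖H t‖ ^ 2 * reDigammaQuarter t with hA
  set q : ℝ := (weilQuadratic g).re with hq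
  -- (1) bounded polar and prime terms
  have harch : A ≤ 2 * π * q + 2 * π * K * n2 := by
    have h := weilArchIntegral_le_weilQuadratic_re hg hsupp
    have hπ2 : 0 < 2 * π := by positivity
    rw [div_mul_eq_mul_div, one_mul, div_le_iff₀ hπ2] at h
    change A ≤ (q + K * n2) * (2 * π) at h
    linarith
  -- (3) the window estimate
  set D2 : ℝ := 8 * a ^ 3 * T ^ 2 / (N : ℝ) ^ 2 * n2 with hD2
  have hwin : ∀ t ∈ Icc (-T) T, ‖H t‖ ^ 2 ≤ D2 := fun t ht ↦ by
    have h := norm_sq_weilMellin_le_of_grid_zero hg ha hsupp hT hN1 hzero ht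
    rwa [hn2'] at h
  have hD2nn : 0 ≤ D2 := by positivity
  -- pointwise inequality: `ℓ |H|² ≤ 1_{[-T,T]} ℓ D2 + |H|² (ρ - ρ₀)`
  have hpt : ∀ t : ℝ, ℓ * ‖H t‖ ^ 2 ≤
      (Icc (-T) T).indicator (fun _ ↦ ℓ * D2) t + ‖H t‖ ^ 2 * (reDigammaQuarter t - ρ₀) := by
    intro t
    have hρ : ρ₀ ≤ reDigammaQuarter t := reDigammaQuarter_zero_le t
    have hnn : 0 ≤ ‖H t‖ ^ 2 * (reDigammaQuarter t - ρ₀) :=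
      mul_nonneg (sq_nonneg _) (sub_nonneg.2 hρ)
    by_cases ht : t ∈ Icc (-T) T
    · rw [indicator_of_mem ht]
      have h1 : ℓ * ‖H t‖ ^ 2 ≤ ℓ * D2 := mul_le_mul_of_nonneg_left (hwin t ht) hℓpos.le
      linarith
    · rw [indicator_of_notMem ht, zero_add]
      have hTt : T ≤ |t| := by
        simp only [mem_Icc, not_and_or, not_le] at ht
        rcases ht with h | h
        · rw [abs_of_neg (by linarith)]; linarith
        · exact h.le.trans (le_abs_self t)
      have hLt : L ≤ reDigammaQuarter t := hLT t hTt
      have hw : ℓ ≤ reDigammaQuarter t - ρ₀ := by rw [hℓ]; linarith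
      exact mul_comm ℓ (‖H t‖ ^ 2) ▸ mul_le_mul_of_nonneg_left hw (sq_nonneg _)
  -- integrability
  have hint_H : Integrable fun t : ℝ ↦ ‖H t‖ ^ 2 := integrable_norm_sq_weilMellin_half_line hg
  have hint_lhs : Integrable fun t : ℝ ↦ ℓ * ‖H t‖ ^ 2 := hint_H.const_mul ℓ
  have hint_ind : Integrable ((Icc (-T) T).indicator fun _ : ℝ ↦ ℓ * D2) :=
    (continuous_const.continuousOn.integrableOn_compact isCompact_Icc).integrable_indicator
      measurableSet_Icc
  have hint_w : Integrable fun t : ℝ ↦ ‖H t‖ ^ 2 * (reDigammaQuarter t - ρ₀) := by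
    have h := (integrable_norm_sq_weilMellin_mul_reDigammaQuarter hg).sub (hint_H.mul_const ρ₀)
    refine h.congr (Eventually.of_forall fun t ↦ ?_)
    simp only [Pi.sub_apply, hH]
    ring
  have hint_rhs : Integrable fun t : ℝ ↦
      (Icc (-T) T).indicator (fun _ ↦ ℓ * D2) t + ‖H t‖ ^ 2 * (reDigammaQuarter t - ρ₀) :=
    hint_ind.add hint_w
  have hmono := integral_mono hint_lhs hint_rhs hpt
  rw [integral_add hint_ind hint_w, integral_const_mul] at hmono
  -- evaluate the pieces
  have hP : ∫ t : ℝ, ‖H t‖ ^ 2 = 2 * π * n2 := by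
    simp only [hH]
    rw [integral_norm_sq_weilMellin_half_line hg, hn2']
  have hI : ∫ t : ℝ, (Icc (-T) T).indicator (fun _ : ℝ ↦ ℓ * D2) t = 2 * T * (ℓ * D2) := by
    rw [integral_indicator measurableSet_Icc, setIntegral_const, smul_eq_mul,
      Real.volume_real_Icc_of_le (by linarith)]
    ring
  have hW : ∫ t : ℝ, ‖H t‖ ^ 2 * (reDigammaQuarter t - ρ₀) = A - 2 * π * ρ₀ * n2 := by
    simp_rw [mul_sub]
    rw [integral_sub (by simpa [hH] using integrable_norm_sq_weilMellin_mul_reDigammaQuarter hg)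
      (hint_H.mul_const ρ₀), integral_mul_const, hP, hA]
    ring
  rw [hP, hI, hW] at hmono
  -- (3') the window contribution is at most `ℓ π n2`
  have hwin_int : 2 * T * (ℓ * D2) ≤ ℓ * (π * n2) := by
    have h16 : 16 * a ^ 3 * T ^ 3 / (N : ℝ) ^ 2 ≤ π := by
      rw [div_le_iff₀ (by positivity)]
      have := hNsq
      rw [div_le_iff₀ Real.pi_pos] at this
      linarith
    have e : 2 * T * (ℓ * D2) = ℓ * (16 * a ^ 3 * T ^ 3 / (N : ℝ) ^ 2 * n2) := by
      rw [hD2]; ring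
    rw [e]
    refine mul_le_mul_of_nonneg_left ?_ hℓpos.le
    exact mul_le_mul_of_nonneg_right h16 hn2nn
  -- assembly
  have hℓn : (2 * μ + 2 * K - 2 * ρ₀) * n2 ≤ ℓ * n2 := mul_le_mul_of_nonneg_right hℓge hn2nn
  have key : π * (2 * (μ * n2)) ≤ π * (2 * q) := by
    have e1 : ℓ * (2 * π * n2) = 2 * (π * (ℓ * n2)) := by ring
    have e2 : ℓ * (π * n2) = π * (ℓ * n2) := by ring
    have e3 : 2 * π * ρ₀ * n2 = 2 * (π * (ρ₀ * n2)) := by ring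
    have e4 : 2 * π * K * n2 = 2 * (π * (K * n2)) := by ring
    rw [e1] at hmono
    rw [e2] at hwin_int
    rw [e3] at hmono
    rw [e4] at harch
    have h5 : π * ((2 * μ + 2 * K - 2 * ρ₀) * n2) ≤ π * (ℓ * n2) :=
      mul_le_mul_of_nonneg_left hℓn Real.pi_pos.le
    have e5 : π * ((2 * μ + 2 * K - 2 * ρ₀) * n2) =
        π * (2 * (μ * n2)) + 2 * (π * (K * n2)) - 2 * (π * (ρ₀ * n2)) := by ring
    rw [e5] at h5
    nlinarith [hmono, hwin_int, harch, h5]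
  have := le_of_mul_le_mul_left key Real.pi_pos
  linarith

/-- **Lemma 3 with Yoshida's uniformity clause `0 < a ≤ a₀`** (fine-grid variant): the grid of
`weilQuadratic_re_ge_of_grid_zero` for the window `a₀` serves every window `a ≤ a₀`, because a
test function on `[-a, a]` is one on `[-a₀, a₀]`. [cite: Yoshida1992HermitianForms, §3 Lemma 3 (p. 290)] -/
theorem weilQuadratic_re_ge_of_grid_zero_uniform {a₀ : ℝ} (ha₀ : 0 < a₀) (μ : ℝ) :
    ∃ T : ℝ, 0 < T ∧ ∃ N : ℕ, 1 ≤ N ∧ ∀ a : ℝ, a ≤ a₀ → ∀ g : ℝ → ℂ, IsWeilTest g →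
      tsupport g ⊆ Icc (-a) a →
      (∀ j : ℕ, j ≤ N → weilMellin g (1 / 2 + ((-T + j * (2 * T / N) : ℝ) : ℂ) * I) = 0) →
      μ * ∫ t : ℝ, ‖g t‖ ^ 2 ≤ (weilQuadratic g).re := by
  obtain ⟨T, hT, N, hN, h⟩ := weilQuadratic_re_ge_of_grid_zero ha₀ μ
  exact ⟨T, hT, N, hN, fun a ha g hg hsupp hzero ↦
    h g hg (hsupp.trans (Icc_subset_Icc (neg_le_neg ha) ha)) hzero⟩

/-- **Positivity modulo finitely many linear conditions on every window** (the case `μ = 0`):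
for every `a > 0` there are `T > 0`, `N ≥ 1` such that `Re Q(g) ≥ 0` for every test function `g` on
`[-a, a]` whose transform vanishes at the `N + 1` grid points of `[-T, T]` — unconditionally, on
windows of any size (compare Weil's criterion `riemannHypothesis_iff_forall_weilPositivityOn`:
positivity WITHOUT conditions on every window is RH). [cite: Yoshida1992HermitianForms, §3 Lemma 3 (p. 290)] -/
theorem weilQuadratic_re_nonneg_of_grid_zero {a : ℝ} (ha : 0 < a) :
    ∃ T : ℝ, 0 < T ∧ ∃ N : ℕ, 1 ≤ N ∧ ∀ g : ℝ → ℂ, IsWeilTest g → tsupport g ⊆ Icc (-a) a →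
      (∀ j : ℕ, j ≤ N → weilMellin g (1 / 2 + ((-T + j * (2 * T / N) : ℝ) : ℂ) * I) = 0) →
      0 ≤ (weilQuadratic g).re := by
  obtain ⟨T, hT, N, hN, h⟩ := weilQuadratic_re_ge_of_grid_zero ha 0
  exact ⟨T, hT, N, hN, fun g hg hsupp hzero ↦ by simpa using h g hg hsupp hzero⟩

end Literature.NumberTheory.LFunctions

end
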